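/-
Copyright (c) 2026 the pub-hodgecm-mathlib formalisation cell (harness21).  Prover seat hodgecm-mathlib-K2Liu-p02 (g5), Track B «K2-LIT» ∕ hLiu418
#184♮, Road I v3 (LEAD F0P6-plan (g12) «M-156b∕c»); discharges flag (F2) of this seat's U4b report (the slot majorants of ★ `K2LiuLineThetaNonvanishing`
for an ARBITRARY rank-2 real frame).  2026-09-04.
-/
import Literature.NumberTheory.Automorphic.Liu2021.ThetaLiftFromLineMajorants     -- ★ the engine's CM wrappers, `TW_eq_realDiagonal`, `coe_realSubfield_ne_zero`
import Literature.NumberTheory.Automorphic.Liu2021.ThetaLiftFromLineMeets         -- ★ `lineThetaKernelDatum` (docstring target)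
import HarnessLib

/-!
# K2_Liu road (hLiu418 = stmt-HodgeConjecture-24832): Weil's theta majorants for `U(diag d_V) × U(⟨a⟩)` at the LINE splitting for EVERY real
# frame of RANK TWO — no sign hypothesis ([Weil1964, n° 41 Lemme 5 ∕ Thm. 6], rank profile (J1) at every real place)

Cell `pub/hodgecm-mathlib` (D-0151), Track B, build stream 29.  ★ `Liu2021.hasThetaMajorants_lineThetaKernelDatum` discharges the binder
`hρ : HasThetaMajorants fun p Φ => pairRep L⁺ L c̄ N 1 e₁ (diagonal d_V) (J_W a) (chiSplittingLine … (T_W a) … (J_W a) …) p Φ` from SIGN FACTS on the frame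
(«all but one of the `re ι₁(d_V i)` share a sign, `d_V` definite through every other complex embedding» — the real pair `U(N−1,1) × U(1)` at ONE place,
`U(N) × U(1)` elsewhere), and ★ `…_twoTwo` from the `(N−2,2)` profile.  For a frame of RANK `N = 2` NO hypothesis is needed: at every real place `v` the
real pair is `U(2) × U(1)`, `U(1,1) × U(1)` or `U(0,2) × U(1)`, and after ORIENTING the place by the sign of `re σ_v(d_V 0)` (the engine ★
`Weil1964.hasThetaMajorants_omega_pairSplitting_canonical` takes an ARBITRARY non-zero per-place scaling `cV`) the first factor has at most ONE
negative index while the line is definite — rank profile (J1) of ★ `Weil1964.nonempty_anyLeviKAKInput_of_card_le_one` («first factor of real rank `≤ 1`,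
second factor compact»: ★ `LeviKAKInput.junction` ∕ `junctionCompact`).  So Weil's Lemme 5 holds in the tree for EVERY non-degenerate rank-2 real diagonal
frame and every line — the frames of socket #42F′ `sig_K2LiuFirstTermIdentityOnGenerators` (`dV : Fin 2 → L` arbitrary) and the two SLOT frames
`F₁ = dD ∘ castAdd`, `F₂ = dD ∘ natAdd = −F₁` (rank `n = 2`) of ★ `K2LiuLineThetaNonvanishing` (organ U4b), at `⟨a⟩`, `⟨(−1)·a⟩`, `⟨−a⟩`, for `μ` and `μ⁻¹`:
its seven majorant binders are ALL instances of `hasThetaMajorants_lineThetaKernelDatum_rankTwo` (after `obtain rfl : n = 2`), the doubled one of ★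
`hasThetaMajorants_pairRep_dD`.

* `hasThetaMajorants_pairRep_line_rankTwo` — any compatible continuous splitting `s` of the line datum, any spelling `T_W = realDiagonal d_W`;
* `hasThetaMajorants_pairRep_chiSplittingLine_rankTwo` — at `s := chiSplittingLine … χ …`;
* `hasThetaMajorants_pairRep_chiSplittingLine_TW_rankTwo` — the T5 spelling (Gram `T_W a`, form `J_W a`, `hJW := JW_eq`);
* **`hasThetaMajorants_lineThetaKernelDatum_rankTwo`** — its instance at `χ := toHeckeCharacter L μ`, `μ` conjugate-symplectic: the literal `hρ` of ★
  `lineThetaKernelDatum L 2 e₁ dV hdV hdV0 μ hμ a hρ`, with NO sign hypothesis.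

No definition, no instance, no named fact, no `sorry`; axioms ⊆ {propext, Classical.choice, Quot.sound}.  HONEST LABEL: HC_CM is proved only modulo the 7 printed
citations (2 remaining named inputs: hLiu418 = stmt-HodgeConjecture-24832, h413 = stmt-HodgeConjecture-24833) until rung 0 closes; this file re-uses the tree's proof of
Weil's Lemme 5 at one more rank profile and retires nothing (`--supports stmt-HodgeConjecture-24832` helper).

## References
* [Weil1964] A. Weil, *Sur certains groupes d'opérateurs unitaires*, Acta Math. 111 (1964), Chap. III n° 41 Lemme 5 p. 194, Thm. 6 (1) p. 193.
* [GelbartRogawski1991] S. Gelbart, J. Rogawski, Invent. Math. 105 (1991), §3.1 Prop. 3.1.1 p. 455.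
* [Liu2021] Y. Liu, Camb. J. Math. 9 (2021) = arXiv:2102.11518, App. B (doubling), App. D §D.1 Steps 1–2.
* [KonnoKonno2007] T. Konno, K. Konno, Kyushu J. Math. 61 (2007), §3.1 (3.1).  [Knapp2002] Thm 7.39.  [Folland1989] §4.2 (4.24), Prop. (4.39).
-/

set_option autoImplicit false
set_option linter.dupNamespace false

noncomputable section

open NumberField NumberField.InfinitePlace IsDedekindDomain
open scoped Matrix

namespace Summit.HodgeConjecture.HodgeConjecture.Cruxes.HLiu418.K2LiuLineThetaMajorantsRankTwo

open Literature.NumberTheory.Automorphic Literature.NumberTheory.Automorphic.UnitaryGroup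
open Literature.NumberTheory.Automorphic.IdeleClassGroup
open Literature.NumberTheory.Automorphic.Liu2021
open Literature.NumberTheory.Automorphic.Liu2021.Def411WeilCarriers
open Literature.NumberTheory.Automorphic.Liu2021.Def411WeilCarriersDoubling
open Literature.NumberTheory.GelbartRogawski1991 Literature.NumberTheory.GelbartRogawski1991.UnitaryDualPair
open Literature.NumberTheory.Weil1964
open Literature.NumberTheory.GaloisRepresentations (HeckeCharacter)
open Literature.RepresentationTheory.HarrisKudlaSweet1996 (IsSplittingChar)
open Literature.RepresentationTheory.Liu2021

variable (L : Type) [Field L] [NumberField L] [IsCMField L] {n' : ℕ} (e₁ : Fin 2 × Fin 1 ≃ Fin n')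
  (dV : Fin 2 → L) (hdV : ∀ i, IsCMField.complexConj L (dV i) = dV i) (hdV0 : ∀ i, dV i ≠ 0)

/-! ## §1 Any compatible continuous splitting of the line datum, rank-2 frame, NO sign hypothesis -/

set_option maxHeartbeats 1600000 in
-- heartbeats: the `subst` runs through the `splittingDatum` telescope of the line datum (as in ★ `hasThetaMajorants_pairRep_line_of_signs`).
/-- **Weil's majorants for ANY compatible continuous splitting of the line datum `(U(diag d_V), U(J_W))` with `d_V : Fin 2 → L` an ARBITRARY
non-degenerate real frame** (any spelling `T_W` of the line's real Gram matrix with `T_W = realDiagonal d_W`): `(u₁, u₂) ↦ ω_ψ(s_pair(u₁, u₂))`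
`HasThetaMajorants` — ★ `Weil1964.hasThetaMajorants_omega_pairSplitting_canonical` after `subst`, per-place orientation `cV v := σ_v(d_V 0)`, rank profile (J1) ★ `nonempty_anyLeviKAKInput_of_card_le_one` at every place.
[cite: Weil1964, Chap. III n° 41 Lemme 5 p. 194, Thm. 6 (1) p. 193] [cite: GelbartRogawski1991, §3.1 Prop. 3.1.1 p. 455] [cite: KonnoKonno2007, §3.1 (3.1)] -/
theorem hasThetaMajorants_pairRep_line_rankTwo (dW : Fin 1 → L) (hdW : ∀ i, IsCMField.complexConj L (dW i) = dW i)
    (hdW0 : ∀ i, dW i ≠ 0) (TW : Matrix (Fin 1) (Fin 1) ↥(maximalRealSubfield L)) (hTW : TW = realDiagonal L dW hdW)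
    (hW : TW.IsSymm) (hWd : IsUnit TW.det) (JW : Matrix (Fin 1) (Fin 1) L)
    (hJW : JW = TW.map (algebraMap (↥(maximalRealSubfield L)) L))
    {s : UnitaryGroup.adelicPair (↥(maximalRealSubfield L)) L (IsCMField.complexConj L) 2 1 (Matrix.diagonal dV) JW →*
      adelicMpCont (↥(maximalRealSubfield L)) (Fin n') (adelicGram (↥(maximalRealSubfield L)) e₁ (realDiagonal L dV hdV) TW)}
    (hs : (splittingDatum (↥(maximalRealSubfield L)) L (IsCMField.complexConj L) 2 1 e₁ (Matrix.diagonal dV) JW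
      (complexConj_imagUnit L) (imagUnit_ne_zero L) (imagUnit_mul_self L) (realDiagonal_isSymm L dV hdV) hW
      (isUnit_det_realDiagonal L dV hdV hdV0) hWd (realDiagonal_map L dV hdV).symm hJW).IsCompatible s)
    (hsc : Continuous s) :
    HasThetaMajorants fun
      (p : ↥(UnitaryGroup.adelic (↥(maximalRealSubfield L)) L (IsCMField.complexConj L) 2 (Matrix.diagonal dV)) ×
        ↥(UnitaryGroup.adelic (↥(maximalRealSubfield L)) L (IsCMField.complexConj L) 1 JW))
      (Φ : piSchwartzBruhat (↥(maximalRealSubfield L)) (Fin n')) =>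
        pairRep (↥(maximalRealSubfield L)) L (IsCMField.complexConj L) 2 1 e₁ (Matrix.diagonal dV) JW s p Φ := by
  subst hTW
  have hV0 : ∀ (v : {v : InfinitePlace ↥(maximalRealSubfield L) // v.IsReal}) i, embedding_of_isReal v.2 (cmRealVec L dV hdV i) ≠ 0 :=
    fun v i => (map_ne_zero _).2 fun h => hdV0 i (congrArg Subtype.val h)
  have hW0 : ∀ (v : {v : InfinitePlace ↥(maximalRealSubfield L) // v.IsReal}) j, embedding_of_isReal v.2 (cmRealVec L dW hdW j) ≠ 0 :=
    fun v j => (map_ne_zero _).2 fun h => hdW0 j (congrArg Subtype.val h)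
  refine hasThetaMajorants_omega_pairSplitting_canonical L (IsCMField.complexConj L) 2 1 e₁ (cmRealVec L dV hdV) (cmRealVec L dW hdW)
    (realDiagonal_map L dV hdV).symm hJW (complexConj_imagUnit L) (imagUnit_ne_zero L) (imagUnit_mul_self L)
    (realDiagonal_isSymm L dV hdV) hW (IsCMField.complexConj_ne_one L) (cmPlaceOver L) (cmPlaceOver_smul L) (cmPlaceOver_comap L)
    (fun v => embedding_of_isReal v.2 (cmRealVec L dV hdV 0)) (fun v => hV0 v 0) (isUnit_det_realDiagonal L dV hdV hdV0) hWd
    (fun v => ?_) hs hsc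
  -- rank profile (J1) at the real place `v`, oriented by `σ_v(d_V 0)`: the index `0` of the first factor is positive (`σ_v(d_V 0)∕σ_v(d_V 0) = 1`),
  -- so at most the index `1` is negative (real rank `≤ 1`); the line's single sign makes one of `PosIdx ∕ NegIdx` empty (compact second factor).
  have hx : ∀ i : Fin 2, i ≠ 1 →
      0 < placeSignVec (cmRealVec L dV hdV) (fun v => embedding_of_isReal v.2 (cmRealVec L dV hdV 0)) v i := by
    intro i hi
    have hi0 : i = 0 := by
      rcases Fin.exists_fin_two.mp ⟨i, rfl⟩ with h | h
      · exact h
      · exact absurd h hi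
    subst hi0
    show 0 < embedding_of_isReal v.2 (cmRealVec L dV hdV 0) / embedding_of_isReal v.2 (cmRealVec L dV hdV 0)
    rw [div_self (hV0 v 0)]
    exact one_pos
  have hy0 : placeSignVec (cmRealVec L dW hdW) (fun v =>
      ((cmPlaceOver L v).1.embedding (imagUnit L)).im /
        embedding_of_isReal v.2 (cmRealVec L dV hdV 0)) v 0 ≠ 0 :=
    div_ne_zero (hW0 v 0) (div_ne_zero (im_embedding_cmPlaceOver_imagUnit_ne_zero L v) (hV0 v 0))
  refine nonempty_anyLeviKAKInput_of_card_le_one (card_negIdx_le_one 1 hx) ?_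
  rcases lt_or_gt_of_ne hy0 with h | h
  · exact Or.inl (isEmpty_posIdx fun j => by rwa [Subsingleton.elim j 0])
  · exact Or.inr (isEmpty_negIdx fun j => by rwa [Subsingleton.elim j 0])

set_option maxHeartbeats 1600000 in
/-- **Weil's majorants at the line's `χ`-SPLITTING, rank-2 frame, NO sign hypothesis** (any spelling `T_W = realDiagonal d_W`).
[cite: Weil1964, Chap. III n° 41 Lemme 5 p. 194, Thm. 6 (1) p. 193] [cite: Liu2021, App. D §D.1 Steps 1–2 (l. 5217–5219)] [cite: GelbartRogawski1991, §3.1 Prop. 3.1.1 p. 455] -/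
theorem hasThetaMajorants_pairRep_chiSplittingLine_rankTwo (χ : HeckeCharacter L) (hχu : χ.IsUnitary) (hχs : IsSplittingChar L 1 χ)
    (dW : Fin 1 → L) (hdW : ∀ i, IsCMField.complexConj L (dW i) = dW i) (hdW0 : ∀ i, dW i ≠ 0)
    (TW : Matrix (Fin 1) (Fin 1) ↥(maximalRealSubfield L)) (hTW : TW = realDiagonal L dW hdW)
    (hW : TW.IsSymm) (hWd : IsUnit TW.det) (JW : Matrix (Fin 1) (Fin 1) L)
    (hJW : JW = TW.map (algebraMap (↥(maximalRealSubfield L)) L)) :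
    HasThetaMajorants fun
      (p : ↥(UnitaryGroup.adelic (↥(maximalRealSubfield L)) L (IsCMField.complexConj L) 2 (Matrix.diagonal dV)) ×
        ↥(UnitaryGroup.adelic (↥(maximalRealSubfield L)) L (IsCMField.complexConj L) 1 JW))
      (Φ : piSchwartzBruhat (↥(maximalRealSubfield L)) (Fin n')) =>
        pairRep (↥(maximalRealSubfield L)) L (IsCMField.complexConj L) 2 1 e₁ (Matrix.diagonal dV) JW
          (chiSplittingLine L e₁ dV hdV hdV0 χ hχu hχs TW hWd JW hJW) p Φ :=
  hasThetaMajorants_pairRep_line_rankTwo L e₁ dV hdV hdV0 dW hdW hdW0 TW hTW hW hWd JW hJW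
    (isCompatible_chiSplittingLine L e₁ dV hdV hdV0 χ hχu hχs TW hW hWd JW hJW)
    (continuous_chiSplittingLine L e₁ dV hdV hdV0 χ hχu hχs TW hWd JW hJW)

/-! ## §2 The T5 ∕ U6 spelling: Gram `T_W a = !![a]`, form `J_W a`, `hJW := JW_eq` -/

set_option maxHeartbeats 1600000 in
/-- **THE BINDER `hρ` FOR A RANK-2 FRAME, SIGN-FREE** — Weil's majorants for `pairRep … (diagonal d_V) (J_W a) (chiSplittingLine … χ … (T_W a) … (J_W a) (JW_eq …))`
for every unitary splitting character `χ`, every line `a` and EVERY non-degenerate real frame `d_V : Fin 2 → L`.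
[cite: Weil1964, Chap. III n° 41 Lemme 5 p. 194, Thm. 6 (1) p. 193] [cite: Liu2021, App. D §D.1 Steps 1–2 (l. 5215–5219)] [cite: GelbartRogawski1991, §3.1 Prop. 3.1.1 p. 455] -/
theorem hasThetaMajorants_pairRep_chiSplittingLine_TW_rankTwo (χ : HeckeCharacter L) (hχu : χ.IsUnitary) (hχs : IsSplittingChar L 1 χ)
    (a : (↥(maximalRealSubfield L))ˣ) :
    HasThetaMajorants fun
      (p : ↥(UnitaryGroup.adelic (↥(maximalRealSubfield L)) L (IsCMField.complexConj L) 2 (Matrix.diagonal dV)) ×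
        ↥(UnitaryGroup.adelic (↥(maximalRealSubfield L)) L (IsCMField.complexConj L) 1 (JW (↥(maximalRealSubfield L)) L a)))
      (Φ : piSchwartzBruhat (↥(maximalRealSubfield L)) (Fin n')) =>
        pairRep (↥(maximalRealSubfield L)) L (IsCMField.complexConj L) 2 1 e₁ (Matrix.diagonal dV) (JW (↥(maximalRealSubfield L)) L a)
          (chiSplittingLine L e₁ dV hdV hdV0 χ hχu hχs (TW (↥(maximalRealSubfield L)) a)
            (isUnit_det_TW (↥(maximalRealSubfield L)) a) (JW (↥(maximalRealSubfield L)) L a) (JW_eq (↥(maximalRealSubfield L)) L a)) p Φ :=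
  hasThetaMajorants_pairRep_chiSplittingLine_rankTwo L e₁ dV hdV hdV0 χ hχu hχs _ (complexConj_coe_realSubfield L a)
    (coe_realSubfield_ne_zero L a) (TW (↥(maximalRealSubfield L)) a) (TW_eq_realDiagonal L a) (isSymm_TW (↥(maximalRealSubfield L)) a)
    (isUnit_det_TW (↥(maximalRealSubfield L)) a) (JW (↥(maximalRealSubfield L)) L a) (JW_eq (↥(maximalRealSubfield L)) L a)

set_option maxHeartbeats 1600000 in
/-- **the literal `hρ` of ★ `lineThetaKernelDatum L 2 e₁ dV hdV hdV0 μ hμ a hρ`, SIGN-FREE** (`χ := toHeckeCharacter L μ`, `μ` conjugate-symplectic; every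
line `a`, every real frame `d_V : Fin 2 → L`) — the rank-2 slot majorants `hρA … hρn′` of ★ `K2LiuLineThetaNonvanishing` (organ U4b) at the #42F′ frame
(`n = 2`), at `⟨a⟩`, `⟨(−1)·a⟩`, `⟨−a⟩`, for `μ` and `μ⁻¹`, are all instances. [cite: Weil1964, Chap. III n° 41 Lemme 5 p. 194, Thm. 6 (1) p. 193]
[cite: Liu2021, App. D §D.1 Steps 1–2 (l. 5215–5219)] -/
theorem hasThetaMajorants_lineThetaKernelDatum_rankTwo (μ : Literature.NumberTheory.Automorphic.IdeleClassGroup L →ₜ* Circle)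
    (hμ : IsConjugateSymplectic L μ) (a : (↥(maximalRealSubfield L))ˣ) :
    HasThetaMajorants fun
      (p : ↥(UnitaryGroup.adelic (↥(maximalRealSubfield L)) L (IsCMField.complexConj L) 2 (Matrix.diagonal dV)) ×
        ↥(UnitaryGroup.adelic (↥(maximalRealSubfield L)) L (IsCMField.complexConj L) 1 (JW (↥(maximalRealSubfield L)) L a)))
      (Φ : piSchwartzBruhat (↥(maximalRealSubfield L)) (Fin n')) =>
        pairRep (↥(maximalRealSubfield L)) L (IsCMField.complexConj L) 2 1 e₁ (Matrix.diagonal dV) (JW (↥(maximalRealSubfield L)) L a)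
          (chiSplittingLine L e₁ dV hdV hdV0 (toHeckeCharacter L μ) (isUnitary_toHeckeCharacter L μ)
            ((isOscillatorChar_toHeckeCharacter_iff μ).mpr hμ) (TW (↥(maximalRealSubfield L)) a)
            (isUnit_det_TW (↥(maximalRealSubfield L)) a) (JW (↥(maximalRealSubfield L)) L a) (JW_eq (↥(maximalRealSubfield L)) L a)) p Φ :=
  hasThetaMajorants_pairRep_chiSplittingLine_TW_rankTwo L e₁ dV hdV hdV0 (toHeckeCharacter L μ) (isUnitary_toHeckeCharacter L μ)
    ((isOscillatorChar_toHeckeCharacter_iff μ).mpr hμ) a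

end Summit.HodgeConjecture.HodgeConjecture.Cruxes.HLiu418.K2LiuLineThetaMajorantsRankTwo

end
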